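import Mathlib
import Summits.KontsevichZagierPeriods.KontsevichZagierPeriods.Theorems.InverseLandauTateFamilyKernelStubGpDivision

/-!
# Crux `TateFamilyKernel` (stmt-KontsevichZagierPeriods-9130), line `Sketch` — `stub_primitiveAlgebra`
# (wave 15, pure commutative algebra in `MvPolynomial (Fin 2) ℚ`)

Variables: `X 0 = s`, `X 1 = ϖ`; `pderiv 0` is the `s`-derivative. Write `D_a := 1 − ϖ·τ_a(s)`,
`D_b := 1 − ϖ·τ_b(s)`, `D_a(0) := 1 − ϖ·τ_a(0)`, `D_b(0)` likewise, and
`D̂ := D_a^k D_b^k D_a(0)^k D_b(0)^k`. If both faces are exact in Hermite form,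
`c_a N_a = ∂_s M_a · D_a − k M_a ∂_s D_a` and `c_b N_b = ∂_s M_b · D_b − k M_b ∂_s D_b`
(`c_a, c_b ∈ ℚ[ϖ] ∖ 0`), then with `c := c_a c_b` and

  `N_E := c_b (M_a D_a(0)^k − M_a(0,ϖ) D_a^k) D_b^k D_b(0)^k`
  `      + c_a (M_b D_b(0)^k − M_b(0,ϖ) D_b^k) D_a^k D_a(0)^k`

one has `N_E/(c D̂) = R − R|_{s=0}` for `R := M_a/(c_a D_a^k) + M_b/(c_b D_b^k)`, hence
`N_E(0,ϖ) ≡ 0` and `∂_s (N_E/(c D̂)) = N_a/D_a^{k+1} + N_b/D_b^{k+1}`; the statement is the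
cross-multiplied form
`(∂_s N_E · cD̂ − N_E · ∂_s(cD̂)) (D_a D_b)^{k+1} = (N_a D_b^{k+1} + N_b D_a^{k+1}) (cD̂)²`.

Proof: the substitution `s ↦ 0`, i.e. `bind₁ ![0, X 1]` (which, in the registered statement
`bind₁ ![0, X 1] NE = 0`, elaborates with values in `MvPolynomial ℕ ℚ` — harmless, it is still
the substitution `X 0 ↦ 0, X 1 ↦ X 1`), is a ring morphism fixing `ℚ[ϖ]` and sending
`D_a ↦ D_a(0)`, `M_a ↦ M_a(0,ϖ)`, whence `N_E(0,ϖ) = 0`. For the identity, all `s`-derivatives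
are expanded by the Leibniz rule, the `s`-derivatives of `ϖ`-only quantities vanish, the power
rule is used in the subtraction-free form `∂(D^k)·D = k D^k ∂D`, and what remains is a ring
identity in opaque atoms (`linear_combination` of the two Hermite relations and the two power
rules).

Mathlib plus the landed `GpDivision.pderiv_zero_scalar` (`∂_s u(ϖ) = 0`); no named fact, no new
definition. Helpers live in the sub-namespace `PrimitiveAlgebra`. [folklore]
-/

noncomputable section

open MeasureTheory Set MvPolynomial

namespace Summit.KontsevichZagierPeriods.InverseLandau.TateFamilyKernel.Descent

namespace PrimitiveAlgebra

/-- `∂_s ϖ = 0`. -/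
theorem pderiv_zero_X_one : pderiv 0 (X 1 : MvPolynomial (Fin 2) ℚ) = 0 :=
  pderiv_X_of_ne (by decide)

/-- The value at `s = 0` of a polynomial in `(s, ϖ)` has vanishing `s`-derivative. -/
theorem pderiv_zero_bind₁ (M : MvPolynomial (Fin 2) ℚ) :
    pderiv 0 (bind₁ ![(0 : MvPolynomial (Fin 2) ℚ), X 1] M) = 0 := by
  have hi : ∀ i : Fin 2, pderiv 0 ((![(0 : MvPolynomial (Fin 2) ℚ), X 1]) i) = 0 := by
    rw [Fin.forall_fin_two]
    exact ⟨map_zero _, pderiv_zero_X_one⟩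
  induction M using MvPolynomial.induction_on with
  | C a => rw [bind₁_C_right, pderiv_C]
  | add p q hp hq => rw [map_add, map_add, hp, hq, add_zero]
  | mul_X p i hp =>
      rw [map_mul, bind₁_X_right, Derivation.leibniz, hp, hi, smul_zero, smul_zero, add_zero]

/-- `∂_s (1 − ϖ·C r)^k = 0` for a constant `r`. -/
theorem pderiv_zero_const_pow (r : ℚ) (k : ℕ) :
    pderiv 0 ((1 - X 1 * C r : MvPolynomial (Fin 2) ℚ) ^ k) = 0 := by
  have h0 : pderiv 0 (1 - X 1 * C r : MvPolynomial (Fin 2) ℚ) = 0 := by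
    rw [map_sub, Derivation.map_one_eq_zero, Derivation.leibniz, pderiv_C, pderiv_zero_X_one,
      smul_zero, smul_zero, add_zero, sub_zero]
  rw [Derivation.leibniz_pow, h0, smul_zero, smul_zero]

/-- The power rule without truncated subtraction: `∂(a^n)·a = n·a^n·∂a`. -/
theorem pderiv_pow_mul_self (a : MvPolynomial (Fin 2) ℚ) (n : ℕ) :
    pderiv 0 (a ^ n) * a = C (n : ℚ) * a ^ n * pderiv 0 a := by
  cases n with
  | zero => simp
  | succ j =>
      rw [Derivation.leibniz_pow, Nat.add_sub_cancel, smul_eq_mul, nsmul_eq_mul, map_natCast,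
        pow_succ]
      ring

/-- The substitution `s ↦ 0` (valued in `MvPolynomial ℕ ℚ`, as `bind₁ ![0, X 1] NE = 0` elaborates in
the statement) fixes `ϖ = X 1`. -/
theorem bindN_X_one :
    bind₁ ![(0 : MvPolynomial ℕ ℚ), X 1] (X 1 : MvPolynomial (Fin 2) ℚ) = X 1 :=
  bind₁_X_right _ _

/-- The substitution `s ↦ 0` kills `s = X 0`. -/
theorem bindN_X_zero :
    bind₁ ![(0 : MvPolynomial ℕ ℚ), X 1] (X 0 : MvPolynomial (Fin 2) ℚ) = 0 :=
  bind₁_X_right _ _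

/-- The substitution `s ↦ 0` evaluates `τ(s)` to the constant `τ(0)`. -/
theorem bindN_aeval_X_zero (τ : Polynomial ℚ) :
    bind₁ ![(0 : MvPolynomial ℕ ℚ), X 1] (Polynomial.aeval (X 0 : MvPolynomial (Fin 2) ℚ) τ) =
      C (Polynomial.eval 0 τ) := by
  rw [← Polynomial.aeval_algHom_apply, bindN_X_zero, ← Polynomial.coeff_zero_eq_aeval_zero',
    Polynomial.coeff_zero_eq_eval_zero, MvPolynomial.algebraMap_eq]

/-- The substitution `s ↦ 0` fixes polynomials in `ϖ` alone. -/
theorem bindN_aeval_X_one (q : Polynomial ℚ) :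
    bind₁ ![(0 : MvPolynomial ℕ ℚ), X 1] (Polynomial.aeval (X 1 : MvPolynomial (Fin 2) ℚ) q) =
      Polynomial.aeval (X 1 : MvPolynomial ℕ ℚ) q := by
  rw [← Polynomial.aeval_algHom_apply, bindN_X_one]

/-- Substituting `s ↦ 0` twice is substituting once. -/
theorem bindN_bind₁ (M : MvPolynomial (Fin 2) ℚ) :
    bind₁ ![(0 : MvPolynomial ℕ ℚ), X 1] (bind₁ ![(0 : MvPolynomial (Fin 2) ℚ), X 1] M) =
      bind₁ ![(0 : MvPolynomial ℕ ℚ), X 1] M := by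
  have h : ∀ i : Fin 2,
      bind₁ ![(0 : MvPolynomial ℕ ℚ), X 1] ((![(0 : MvPolynomial (Fin 2) ℚ), X 1]) i) =
        (![(0 : MvPolynomial ℕ ℚ), X 1]) i := by
    rw [Fin.forall_fin_two]
    exact ⟨map_zero _, bindN_X_one⟩
  rw [bind₁_bind₁]
  exact congrArg (fun f => bind₁ f M) (funext h)

end PrimitiveAlgebra

open PrimitiveAlgebra in
/-- **The rational primitive of the exact face family.** If both faces are exact,
`c_aN_a = ∂_sM_aD_a − kM_a∂_sD_a` and `c_bN_b = ∂_sM_bD_b − kM_b∂_sD_b` (`c_a, c_b ∈ ℚ[ϖ] ∖ 0`), then there are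
`N_E ∈ ℚ[s,ϖ]` and `c ∈ ℚ[ϖ] ∖ 0` with `N_E(0,ϖ) ≡ 0` and, for `D̂ := D_a^kD_b^kD_a(0,ϖ)^kD_b(0,ϖ)^k`, the
cross-multiplied form of `∂_s(N_E/(cD̂)) = N_a/D_a^{k+1} + N_b/D_b^{k+1}`:
`(∂_sN_E·cD̂ − N_E·∂_s(cD̂))·(D_aD_b)^{k+1} = (N_aD_b^{k+1} + N_bD_a^{k+1})·(cD̂)²` (take
`N_E/(cD̂) = M_a/(c_aD_a^k) + M_b/(c_bD_b^k) − [same at s = 0]`, `c = c_ac_b`). [folklore] -/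
theorem stub_primitiveAlgebra (τa τb : Polynomial ℚ) (k : ℕ) (NA NB Ma Mb : MvPolynomial (Fin 2) ℚ)
    (ca cb : Polynomial ℚ) (hca : ca ≠ 0) (hcb : cb ≠ 0)
    (hHa : Polynomial.aeval (X 1 : MvPolynomial (Fin 2) ℚ) ca * NA =
      pderiv 0 Ma * (1 - X 1 * Polynomial.aeval (X 0 : MvPolynomial (Fin 2) ℚ) τa) -
        C (k : ℚ) * (Ma * pderiv 0 (1 - X 1 * Polynomial.aeval (X 0 : MvPolynomial (Fin 2) ℚ) τa)))
    (hHb : Polynomial.aeval (X 1 : MvPolynomial (Fin 2) ℚ) cb * NB =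
      pderiv 0 Mb * (1 - X 1 * Polynomial.aeval (X 0 : MvPolynomial (Fin 2) ℚ) τb) -
        C (k : ℚ) * (Mb * pderiv 0 (1 - X 1 * Polynomial.aeval (X 0 : MvPolynomial (Fin 2) ℚ) τb))) :
    ∃ (NE : MvPolynomial (Fin 2) ℚ) (c : Polynomial ℚ), c ≠ 0 ∧ bind₁ ![0, X 1] NE = 0 ∧
      (pderiv 0 NE * (Polynomial.aeval (X 1 : MvPolynomial (Fin 2) ℚ) c *
            ((1 - X 1 * Polynomial.aeval (X 0 : MvPolynomial (Fin 2) ℚ) τa) ^ k *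
              (1 - X 1 * Polynomial.aeval (X 0 : MvPolynomial (Fin 2) ℚ) τb) ^ k *
              (1 - X 1 * C (Polynomial.eval 0 τa)) ^ k * (1 - X 1 * C (Polynomial.eval 0 τb)) ^ k)) -
          NE * pderiv 0 (Polynomial.aeval (X 1 : MvPolynomial (Fin 2) ℚ) c *
            ((1 - X 1 * Polynomial.aeval (X 0 : MvPolynomial (Fin 2) ℚ) τa) ^ k *
              (1 - X 1 * Polynomial.aeval (X 0 : MvPolynomial (Fin 2) ℚ) τb) ^ k *
              (1 - X 1 * C (Polynomial.eval 0 τa)) ^ k * (1 - X 1 * C (Polynomial.eval 0 τb)) ^ k))) *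
          ((1 - X 1 * Polynomial.aeval (X 0 : MvPolynomial (Fin 2) ℚ) τa) *
            (1 - X 1 * Polynomial.aeval (X 0 : MvPolynomial (Fin 2) ℚ) τb)) ^ (k + 1) =
        (NA * (1 - X 1 * Polynomial.aeval (X 0 : MvPolynomial (Fin 2) ℚ) τb) ^ (k + 1) +
            NB * (1 - X 1 * Polynomial.aeval (X 0 : MvPolynomial (Fin 2) ℚ) τa) ^ (k + 1)) *
          (Polynomial.aeval (X 1 : MvPolynomial (Fin 2) ℚ) c *
            ((1 - X 1 * Polynomial.aeval (X 0 : MvPolynomial (Fin 2) ℚ) τa) ^ k *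
              (1 - X 1 * Polynomial.aeval (X 0 : MvPolynomial (Fin 2) ℚ) τb) ^ k *
              (1 - X 1 * C (Polynomial.eval 0 τa)) ^ k * (1 - X 1 * C (Polynomial.eval 0 τb)) ^ k)) ^ 2 := by
  refine ⟨Polynomial.aeval (X 1 : MvPolynomial (Fin 2) ℚ) cb *
        (Ma * (1 - X 1 * C (Polynomial.eval 0 τa)) ^ k -
          bind₁ ![(0 : MvPolynomial (Fin 2) ℚ), X 1] Ma *
            (1 - X 1 * Polynomial.aeval (X 0 : MvPolynomial (Fin 2) ℚ) τa) ^ k) *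
        (1 - X 1 * Polynomial.aeval (X 0 : MvPolynomial (Fin 2) ℚ) τb) ^ k *
        (1 - X 1 * C (Polynomial.eval 0 τb)) ^ k +
      Polynomial.aeval (X 1 : MvPolynomial (Fin 2) ℚ) ca *
        (Mb * (1 - X 1 * C (Polynomial.eval 0 τb)) ^ k -
          bind₁ ![(0 : MvPolynomial (Fin 2) ℚ), X 1] Mb *
            (1 - X 1 * Polynomial.aeval (X 0 : MvPolynomial (Fin 2) ℚ) τb) ^ k) *
        (1 - X 1 * Polynomial.aeval (X 0 : MvPolynomial (Fin 2) ℚ) τa) ^ k *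
        (1 - X 1 * C (Polynomial.eval 0 τa)) ^ k,
    ca * cb, mul_ne_zero hca hcb, ?_, ?_⟩
  · -- the value at `s = 0` vanishes
    simp only [map_add, map_sub, map_mul, map_pow, map_one, bindN_X_one, bindN_aeval_X_zero,
      bindN_aeval_X_one, bindN_bind₁, bind₁_C_right, sub_self, zero_mul, mul_zero, add_zero]
  · -- the cross-multiplied derivative identity
    have ha0 := GpDivision.pderiv_zero_scalar ca
    have hb0 := GpDivision.pderiv_zero_scalar cb
    have hMa0 := pderiv_zero_bind₁ Ma
    have hMb0 := pderiv_zero_bind₁ Mb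
    have hP := pderiv_zero_const_pow (Polynomial.eval 0 τa) k
    have hQ := pderiv_zero_const_pow (Polynomial.eval 0 τb) k
    have hEa := pderiv_pow_mul_self (1 - X 1 * Polynomial.aeval (X 0 : MvPolynomial (Fin 2) ℚ) τa) k
    have hEb := pderiv_pow_mul_self (1 - X 1 * Polynomial.aeval (X 0 : MvPolynomial (Fin 2) ℚ) τb) k
    simp only [map_mul]
    generalize Polynomial.aeval (X 1 : MvPolynomial (Fin 2) ℚ) ca = a at hHa ha0 ⊢
    generalize Polynomial.aeval (X 1 : MvPolynomial (Fin 2) ℚ) cb = b at hHb hb0 ⊢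
    generalize bind₁ ![(0 : MvPolynomial (Fin 2) ℚ), X 1] Ma = Ma0 at hMa0 ⊢
    generalize bind₁ ![(0 : MvPolynomial (Fin 2) ℚ), X 1] Mb = Mb0 at hMb0 ⊢
    generalize (1 - X 1 * Polynomial.aeval (X 0 : MvPolynomial (Fin 2) ℚ) τa) = Da at hHa hEa ⊢
    generalize (1 - X 1 * Polynomial.aeval (X 0 : MvPolynomial (Fin 2) ℚ) τb) = Db at hHb hEb ⊢
    generalize (1 - X 1 * C (Polynomial.eval 0 τa) : MvPolynomial (Fin 2) ℚ) = Pa at hP ⊢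
    generalize (1 - X 1 * C (Polynomial.eval 0 τb) : MvPolynomial (Fin 2) ℚ) = Pb at hQ ⊢
    simp only [map_add, map_sub, Derivation.leibniz, smul_eq_mul, ha0, hb0, hMa0, hMb0, hP, hQ,
      mul_zero, add_zero, zero_add, mul_pow]
    linear_combination
      (-(a * b ^ 2 * (Pa ^ k) ^ 2 * (Pb ^ k) ^ 2 * (Da ^ k) ^ 2 * (Db ^ k) ^ 3 * Db)) * hHa +
      (-(a * b ^ 2 * (Pa ^ k) ^ 2 * (Pb ^ k) ^ 2 * (Da ^ k) * (Db ^ k) ^ 3 * Db * Ma)) * hEa +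
      (-(a ^ 2 * b * (Pa ^ k) ^ 2 * (Pb ^ k) ^ 2 * (Da ^ k) ^ 3 * (Db ^ k) ^ 2 * Da)) * hHb +
      (-(a ^ 2 * b * (Pa ^ k) ^ 2 * (Pb ^ k) ^ 2 * (Da ^ k) ^ 3 * (Db ^ k) * Da * Mb)) * hEb
    -- a b² P² Q² U V³ Db (−U δHa − Ma δEa) + a² b P² Q² U³ V Da (−V δHb − Mb δEb)

end Summit.KontsevichZagierPeriods.InverseLandau.TateFamilyKernel.Descent

end
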